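import Summits.QuantumFields.YangMills.Theorems.LocalInsertionHistoryTailOfInsertionLPerPlaquette
import Summits.QuantumFields.YangMills.Theses.LocalInsertion
import HarnessLib

/-!
# Line «local_insertion» on crux `HistoryTailL` (stmt-QuantumFields-19936) — THE CAPPED MOMENT FROM A WINDOW TAIL:
# `LocalInsertionL` (stmt-QuantumFields-23607) and both registered stubs follow from a K-uniform linear-exponential (or Gaussian)
# TAIL of the normalised block flux on the local small-history event

Cell `ym3-torus` (YM ladder rung R3 = continuum SU(2) Yang–Mills on the three-torus — a RUNG, NOT the Clay problem: not d = 4, not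
infinite volume, not a mass gap), width seat `ym-ust-19936-w3` gen 11, `--supports stmt-QuantumFields-19936 --as helper`.  THEOREMS ONLY,
definition-free.  HONEST FRAMING: this file is the CONVERSE ADAPTER of the cross-cell Chernoff step ✓`HistoryTailOfInsertion.chernoff_local`
(moment ⇒ tail): here tail ⇒ capped moment.  Nothing of `LocalInsertionL`, the glue 23608, the stubs `stub_insertionHeightOne` /
`stub_insertionHigher` of `Cruxes/HistoryTailL/Lines/local_insertion.lean`, the crux `HistoryTailL` or any summit statement is proved: every
theorem below is CONDITIONAL on a tail hypothesis that is NOT in the tree.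

WHAT.
* §1 (abstract, Mathlib only) `exp_mul_min_le_sum_ite` — the pointwise staircase under a cap: for `y ≥ 0`,
  `exp(ε·min(y,p)) ≤ Σ_{n ≤ ⌊max p 0⌋} exp(ε(n+1))·1[n ≤ y]` (a FINITE sum because of the cap); ★`setIntegral_exp_mul_min_le_sum`:
  `∫_G exp(ε·min(Y,p)) dμ ≤ Σ_{n ≤ ⌊max p 0⌋} exp(ε(n+1))·μ(G ∩ {n ≤ Y})` for measurable `G`, measurable `Y ≥ 0` on `G`, finite `μ`;
  ★`setIntegral_exp_mul_min_le_of_expTail`: tail `μ(G ∩ {n ≤ Y}) ≤ C e^{−κn}` (`n : ℕ`), `0 ≤ ε < κ` ⇒ `≤ C·e^{ε}/(1 − e^{ε−κ})` for EVERY cap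
  `p`; ★`setIntegral_exp_mul_min_le_of_gaussTail`: Gaussian tail `C e^{−cn²}` beyond a threshold `t₀` on a probability space ⇒
  `≤ (t₀+1)e^{ε(t₀+1)} + 2C·e^{ε + (ε+1)²/(4c)}` for EVERY `ε ≥ 0` and every cap (completing the square, `exp_mul_succ_mul_exp_neg_sq_le`).
* §2 (the line's objects, one instance `(F, γ, K, j, a)`, ARBITRARY measurable event `G` — the same generality as `chernoff_local`)
  ★`insertionIntegral_le_of_expTail` / ★`insertionIntegral_le_of_gaussTail`: a tail of `{n·g_{K−j} ≤ dist1(Ū^j(∂a))} ∩ G` in `n : ℕ`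
  bounds the LocalInsertionL integrand `∫_G exp(ε·min(dist1(Ū^j(∂a))/g_{K−j}, p(g_{K−j}))) dGibbs_K` INDEPENDENTLY of the profile `(b₀,p₀)`.
* §3 (packaging, BY NAME) ★★`localInsertionL_of_windowExpTail`: the K-uniform linear-exponential WINDOW TAIL
  `∀ L ∃ κ>0 ∀ b₀ p₀ ∃ C γ₁ ∀ F γ K j a n, Gibbs_K(G(a,j) ∩ {n·g ≤ dist1(Ū^j(∂a))}) ≤ C·e^{−κn}` gives `Theses.LocalInsertion.LocalInsertionL`
  with `ε := κ/2`, `M₀ := C·e^{κ/2}/(1 − e^{−κ/2})`; ★★`insertionHeightOne_of_windowExpTail` / ★★`insertionHigher_of_windowExpTail`: the same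
  tail at heights `j ≤ 1` resp. `2 ≤ j` gives the REGISTERED STUB SIGNATURES verbatim (`ε₀ := κ/2`; for `ε ≤ ε₀`, `M₀(ε) := C·e^{ε}/(1−e^{ε−κ})`).
So, with ✓`chernoff_local`: `LocalInsertionL` ⟺ a K-uniform linear-exponential tail of the capped normalised flux on the window, up to
`ε ↔ κ` — suppliers (every concentration engine of lines #12/#13/#15) may deliver TAILS.
[folklore]
-/

set_option autoImplicit false

noncomputable section

open scoped BigOperators
open MeasureTheory Set
open Literature.MathematicalPhysics.QuantumFieldTheory.Balaban1983to89
open Literature.MathematicalPhysics.QuantumFieldTheory.Balaban1983to89.T3ContinuumYM3Torus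
open Literature.MathematicalPhysics.QuantumFieldTheory.Balaban1983to89.T3UnitScaleTilt
open Literature.MathematicalPhysics.QuantumFieldTheory.Balaban1983to89.T3UnitLawDensityEML
open Summit.QuantumFields.YangMills.Theorems.LocalInsertion.HistoryTailOfInsertion (measurable_flux measurableSet_localGood)

namespace Summit.QuantumFields.YangMills.Theorems.LocalInsertion.MomentOfWindowTail

/-! ## §1 Abstract: the capped exponential moment from a tail sequence -/

/-- Pointwise staircase under a cap: for `y ≥ 0`, `ε ≥ 0` and any cap `p`,
`exp(ε·min(y,p)) ≤ Σ_{n ≤ ⌊max p 0⌋} exp(ε(n+1))·1[n ≤ y]` (take `n = ⌊min(y,p)⌋₊`). [folklore] -/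
theorem exp_mul_min_le_sum_ite {ε y p : ℝ} (hε : 0 ≤ ε) (hy : 0 ≤ y) :
    Real.exp (ε * min y p) ≤
      ∑ n ∈ Finset.range (⌊max p 0⌋₊ + 1), (if (n : ℝ) ≤ y then Real.exp (ε * (n + 1)) else 0) := by
  set n₀ : ℕ := ⌊min y p⌋₊ with hn₀
  have hlt : min y p < (n₀ : ℝ) + 1 := Nat.lt_floor_add_one _
  have hle : (n₀ : ℝ) ≤ y := by
    by_cases h : 0 ≤ min y p
    · exact (Nat.floor_le h).trans (min_le_left _ _)
    · have : n₀ = 0 := by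
        rw [hn₀]; exact Nat.floor_of_nonpos (le_of_lt (not_le.mp h))
      rw [this]; simpa using hy
  have hmem : n₀ ∈ Finset.range (⌊max p 0⌋₊ + 1) := by
    rw [Finset.mem_range, Nat.lt_add_one_iff, hn₀]
    exact Nat.floor_mono ((min_le_right _ _).trans (le_max_left _ _))
  have hterm : Real.exp (ε * min y p) ≤ (if (n₀ : ℝ) ≤ y then Real.exp (ε * (n₀ + 1)) else 0) := by
    rw [if_pos hle]
    exact Real.exp_le_exp.mpr (mul_le_mul_of_nonneg_left hlt.le hε)
  refine hterm.trans ?_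
  refine Finset.single_le_sum (f := fun n : ℕ => if (n : ℝ) ≤ y then Real.exp (ε * (n + 1)) else 0) ?_ hmem
  intro n _
  split_ifs
  · exact (Real.exp_pos _).le
  · exact le_rfl

/-- **Capped exponential moment from a tail sequence.** On a finite measure space, for a measurable set `G`, a measurable `Y` that is
non-negative on `G`, `ε ≥ 0` and any cap `p`: `∫_G exp(ε·min(Y,p)) dμ ≤ Σ_{n ≤ ⌊max p 0⌋} exp(ε(n+1))·μ(G ∩ {n ≤ Y})`. [folklore] -/
theorem setIntegral_exp_mul_min_le_sum {Ω : Type*} [MeasurableSpace Ω] (μ : Measure Ω) [IsFiniteMeasure μ]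
    {G : Set Ω} (hG : MeasurableSet G) {Y : Ω → ℝ} (hY : Measurable Y) (hY0 : ∀ ω ∈ G, 0 ≤ Y ω)
    {ε : ℝ} (hε : 0 ≤ ε) (p : ℝ) :
    ∫ ω in G, Real.exp (ε * min (Y ω) p) ∂μ ≤
      ∑ n ∈ Finset.range (⌊max p 0⌋₊ + 1), Real.exp (ε * (n + 1)) * μ.real (G ∩ {ω | (n : ℝ) ≤ Y ω}) := by
  have hS : ∀ n : ℕ, MeasurableSet {ω | (n : ℝ) ≤ Y ω} := fun n => measurableSet_le measurable_const hY
  -- the staircase majorant, as a sum of indicator functions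
  set g : Ω → ℝ := fun ω => ∑ n ∈ Finset.range (⌊max p 0⌋₊ + 1),
      {ω | (n : ℝ) ≤ Y ω}.indicator (fun _ => Real.exp (ε * (n + 1))) ω with hg
  have hg_int : Integrable g (μ.restrict G) := by
    refine integrable_finsetSum _ fun n _ => ?_
    exact (integrable_const _).indicator (hS n)
  have hpt : ∀ᵐ ω ∂(μ.restrict G), Real.exp (ε * min (Y ω) p) ≤ g ω := by
    rw [ae_restrict_iff' hG]
    refine ae_of_all _ fun ω hω => ?_
    have h := exp_mul_min_le_sum_ite (p := p) hε (hY0 ω hω)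
    refine h.trans (le_of_eq ?_)
    refine Finset.sum_congr rfl fun n _ => ?_
    simp only [Set.indicator_apply, Set.mem_setOf_eq]
  have hnn : 0 ≤ᵐ[μ.restrict G] fun ω => Real.exp (ε * min (Y ω) p) := ae_of_all _ fun ω => (Real.exp_pos _).le
  calc ∫ ω in G, Real.exp (ε * min (Y ω) p) ∂μ ≤ ∫ ω in G, g ω ∂μ := integral_mono_of_nonneg hnn hg_int hpt
    _ = ∑ n ∈ Finset.range (⌊max p 0⌋₊ + 1), ∫ ω in G, {ω | (n : ℝ) ≤ Y ω}.indicator (fun _ => Real.exp (ε * (n + 1))) ω ∂μ := by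
        rw [hg, integral_finsetSum]
        intro n _
        exact (integrable_const _).indicator (hS n)
    _ = ∑ n ∈ Finset.range (⌊max p 0⌋₊ + 1), Real.exp (ε * (n + 1)) * μ.real (G ∩ {ω | (n : ℝ) ≤ Y ω}) := by
        refine Finset.sum_congr rfl fun n _ => ?_
        rw [integral_indicator_const _ (hS n), measureReal_restrict_apply (hS n), smul_eq_mul, mul_comm, Set.inter_comm]

/-- **Linear-exponential tail ⇒ capped exponential moment, p-uniformly.** If `μ(G ∩ {n ≤ Y}) ≤ C·exp(−κn)` for every `n : ℕ` and
`0 ≤ ε < κ`, then `∫_G exp(ε·min(Y,p)) dμ ≤ C·exp(ε)/(1 − exp(ε−κ))` for EVERY cap `p`. [folklore] -/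
theorem setIntegral_exp_mul_min_le_of_expTail {Ω : Type*} [MeasurableSpace Ω] (μ : Measure Ω) [IsFiniteMeasure μ]
    {G : Set Ω} (hG : MeasurableSet G) {Y : Ω → ℝ} (hY : Measurable Y) (hY0 : ∀ ω ∈ G, 0 ≤ Y ω)
    {ε κ C : ℝ} (hε : 0 ≤ ε) (hεκ : ε < κ) (hC : 0 ≤ C)
    (htail : ∀ n : ℕ, μ.real (G ∩ {ω | (n : ℝ) ≤ Y ω}) ≤ C * Real.exp (-(κ * n))) (p : ℝ) :
    ∫ ω in G, Real.exp (ε * min (Y ω) p) ∂μ ≤ C * Real.exp ε / (1 - Real.exp (ε - κ)) := by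
  have hr0 : 0 ≤ Real.exp (ε - κ) := (Real.exp_pos _).le
  have hr1 : Real.exp (ε - κ) < 1 := Real.exp_lt_one_iff.mpr (by linarith)
  refine (setIntegral_exp_mul_min_le_sum μ hG hY hY0 hε p).trans ?_
  have hterm : ∀ n : ℕ, Real.exp (ε * (n + 1)) * μ.real (G ∩ {ω | (n : ℝ) ≤ Y ω}) ≤
      C * Real.exp ε * Real.exp (ε - κ) ^ n := by
    intro n
    calc Real.exp (ε * (n + 1)) * μ.real (G ∩ {ω | (n : ℝ) ≤ Y ω})
        ≤ Real.exp (ε * (n + 1)) * (C * Real.exp (-(κ * n))) :=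
          mul_le_mul_of_nonneg_left (htail n) (Real.exp_pos _).le
      _ = C * Real.exp ε * Real.exp (ε - κ) ^ n := by
          have h1 : Real.exp (ε * (n + 1)) = Real.exp (ε * n) * Real.exp ε := by
            rw [← Real.exp_add]; ring_nf
          have h2 : Real.exp (ε - κ) ^ n = Real.exp (ε * n) * Real.exp (-(κ * n)) := by
            rw [← Real.exp_nat_mul, ← Real.exp_add]; ring_nf
          rw [h1, h2]; ring
  calc ∑ n ∈ Finset.range (⌊max p 0⌋₊ + 1), Real.exp (ε * (n + 1)) * μ.real (G ∩ {ω | (n : ℝ) ≤ Y ω})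
      ≤ ∑ n ∈ Finset.range (⌊max p 0⌋₊ + 1), C * Real.exp ε * Real.exp (ε - κ) ^ n := Finset.sum_le_sum fun n _ => hterm n
    _ = C * Real.exp ε * ∑ n ∈ Finset.range (⌊max p 0⌋₊ + 1), Real.exp (ε - κ) ^ n := by rw [Finset.mul_sum]
    _ ≤ C * Real.exp ε * (1 - Real.exp (ε - κ))⁻¹ := by
        refine mul_le_mul_of_nonneg_left ?_ (mul_nonneg hC (Real.exp_pos _).le)
        rw [← tsum_geometric_of_lt_one hr0 hr1]
        exact Summable.sum_le_tsum _ (fun n _ => pow_nonneg hr0 n) (summable_geometric_of_lt_one hr0 hr1)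
    _ = C * Real.exp ε / (1 - Real.exp (ε - κ)) := by rw [div_eq_mul_inv]

/-- Completing the square: `exp(ε(n+1))·exp(−c·n²) ≤ exp(ε + (ε+1)²/(4c))·exp(−n)` for `c > 0`. [folklore] -/
theorem exp_mul_succ_mul_exp_neg_sq_le {ε c : ℝ} (hc : 0 < c) (n : ℝ) :
    Real.exp (ε * (n + 1)) * Real.exp (-(c * n ^ 2)) ≤ Real.exp (ε + (ε + 1) ^ 2 / (4 * c)) * Real.exp (-n) := by
  rw [← Real.exp_add, ← Real.exp_add]
  refine Real.exp_le_exp.mpr ?_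
  have key : -(c * n ^ 2) + (ε + 1) * n ≤ (ε + 1) ^ 2 / (4 * c) := by
    have h4c : 0 < 4 * c := by linarith
    rw [le_div_iff₀ h4c]
    nlinarith [sq_nonneg (2 * c * n - (ε + 1))]
  linarith

/-- **Gaussian tail beyond a threshold ⇒ capped exponential moment, p-uniformly.** On a probability space, if
`μ(G ∩ {n ≤ Y}) ≤ C·exp(−c·n²)` for every `n : ℕ` with `t₀ ≤ n` (`c > 0`, `C, t₀ ≥ 0`), then for every `ε ≥ 0` and EVERY cap `p`:
`∫_G exp(ε·min(Y,p)) dμ ≤ (t₀+1)·exp(ε(t₀+1)) + 2·C·exp(ε + (ε+1)²/(4c))`. [folklore] -/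
theorem setIntegral_exp_mul_min_le_of_gaussTail {Ω : Type*} [MeasurableSpace Ω] (μ : Measure Ω) [IsProbabilityMeasure μ]
    {G : Set Ω} (hG : MeasurableSet G) {Y : Ω → ℝ} (hY : Measurable Y) (hY0 : ∀ ω ∈ G, 0 ≤ Y ω)
    {ε c C t₀ : ℝ} (hε : 0 ≤ ε) (hc : 0 < c) (hC : 0 ≤ C) (ht₀ : 0 ≤ t₀)
    (htail : ∀ n : ℕ, t₀ ≤ (n : ℝ) → μ.real (G ∩ {ω | (n : ℝ) ≤ Y ω}) ≤ C * Real.exp (-(c * (n : ℝ) ^ 2))) (p : ℝ) :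
    ∫ ω in G, Real.exp (ε * min (Y ω) p) ∂μ ≤
      (t₀ + 1) * Real.exp (ε * (t₀ + 1)) + 2 * C * Real.exp (ε + (ε + 1) ^ 2 / (4 * c)) := by
  refine (setIntegral_exp_mul_min_le_sum μ hG hY hY0 hε p).trans ?_
  set N := ⌊max p 0⌋₊ + 1 with hN
  set A := Real.exp (ε + (ε + 1) ^ 2 / (4 * c)) with hA
  -- split the range at the threshold
  have hsplit : ∀ n : ℕ, Real.exp (ε * (n + 1)) * μ.real (G ∩ {ω | (n : ℝ) ≤ Y ω}) ≤
      (if (n : ℝ) < t₀ then Real.exp (ε * (t₀ + 1)) else 0) + C * A * Real.exp (-1 : ℝ) ^ n := by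
    intro n
    have hμ1 : μ.real (G ∩ {ω | (n : ℝ) ≤ Y ω}) ≤ 1 := measureReal_le_one
    have hμ0 : 0 ≤ μ.real (G ∩ {ω | (n : ℝ) ≤ Y ω}) := measureReal_nonneg
    have hgeo : 0 ≤ C * A * Real.exp (-1 : ℝ) ^ n := by positivity
    by_cases hn : (n : ℝ) < t₀
    · rw [if_pos hn]
      have h1 : Real.exp (ε * (n + 1)) * μ.real (G ∩ {ω | (n : ℝ) ≤ Y ω}) ≤ Real.exp (ε * (t₀ + 1)) :=
        calc Real.exp (ε * (n + 1)) * μ.real (G ∩ {ω | (n : ℝ) ≤ Y ω}) ≤ Real.exp (ε * (n + 1)) * 1 :=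
              mul_le_mul_of_nonneg_left hμ1 (Real.exp_pos _).le
          _ ≤ Real.exp (ε * (t₀ + 1)) := by
              rw [mul_one]; exact Real.exp_le_exp.mpr (mul_le_mul_of_nonneg_left (by linarith) hε)
      linarith
    · rw [if_neg hn, zero_add]
      have hn' : t₀ ≤ (n : ℝ) := not_lt.mp hn
      calc Real.exp (ε * (n + 1)) * μ.real (G ∩ {ω | (n : ℝ) ≤ Y ω})
          ≤ Real.exp (ε * (n + 1)) * (C * Real.exp (-(c * (n : ℝ) ^ 2))) :=
            mul_le_mul_of_nonneg_left (htail n hn') (Real.exp_pos _).le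
        _ = C * (Real.exp (ε * (n + 1)) * Real.exp (-(c * (n : ℝ) ^ 2))) := by ring
        _ ≤ C * (A * Real.exp (-(n : ℝ))) := mul_le_mul_of_nonneg_left (exp_mul_succ_mul_exp_neg_sq_le hc n) hC
        _ = C * A * Real.exp (-1 : ℝ) ^ n := by rw [← Real.exp_nat_mul]; ring_nf
  have hr0 : 0 ≤ Real.exp (-1 : ℝ) := (Real.exp_pos _).le
  have hr1 : Real.exp (-1 : ℝ) < 1 := Real.exp_lt_one_iff.mpr (by norm_num)
  have hrhalf : Real.exp (-1 : ℝ) ≤ 1 / 2 := by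
    have h := Real.add_one_le_exp (1 : ℝ)
    rw [Real.exp_neg]
    rw [inv_le_comm₀ (Real.exp_pos _) (by norm_num : (0:ℝ) < 1 / 2)]
    norm_num at h ⊢; linarith
  -- the threshold part: at most `⌊t₀⌋₊ + 1 ≤ t₀ + 1` indices below `t₀`
  have hcount : ∑ n ∈ Finset.range N, (if (n : ℝ) < t₀ then Real.exp (ε * (t₀ + 1)) else 0) ≤
      (t₀ + 1) * Real.exp (ε * (t₀ + 1)) := by
    rw [← Finset.sum_filter]
    rw [Finset.sum_const, nsmul_eq_mul]
    refine mul_le_mul_of_nonneg_right ?_ (Real.exp_pos _).le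
    have hsub : (Finset.range N).filter (fun n : ℕ => (n : ℝ) < t₀) ⊆ Finset.range (⌊t₀⌋₊ + 1) := by
      intro n hn
      rw [Finset.mem_filter] at hn
      rw [Finset.mem_range, Nat.lt_add_one_iff]
      exact Nat.le_floor hn.2.le
    calc (((Finset.range N).filter (fun n : ℕ => (n : ℝ) < t₀)).card : ℝ) ≤ ((Finset.range (⌊t₀⌋₊ + 1)).card : ℝ) := by
          exact_mod_cast Finset.card_le_card hsub
      _ = (⌊t₀⌋₊ : ℝ) + 1 := by rw [Finset.card_range]; push_cast; ring
      _ ≤ t₀ + 1 := by linarith [Nat.floor_le ht₀]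
  have hgeom : ∑ n ∈ Finset.range N, C * A * Real.exp (-1 : ℝ) ^ n ≤ 2 * C * A := by
    rw [← Finset.mul_sum]
    have hs : ∑ n ∈ Finset.range N, Real.exp (-1 : ℝ) ^ n ≤ 2 := by
      calc ∑ n ∈ Finset.range N, Real.exp (-1 : ℝ) ^ n ≤ ∑' n : ℕ, Real.exp (-1 : ℝ) ^ n :=
            Summable.sum_le_tsum _ (fun n _ => pow_nonneg hr0 n) (summable_geometric_of_lt_one hr0 hr1)
        _ = (1 - Real.exp (-1 : ℝ))⁻¹ := tsum_geometric_of_lt_one hr0 hr1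
        _ ≤ 2 := by
            rw [inv_le_comm₀ (by linarith) (by norm_num : (0:ℝ) < 2)]
            linarith
    calc C * A * ∑ n ∈ Finset.range N, Real.exp (-1 : ℝ) ^ n ≤ C * A * 2 :=
          mul_le_mul_of_nonneg_left hs (by positivity)
      _ = 2 * C * A := by ring
  calc ∑ n ∈ Finset.range N, Real.exp (ε * (n + 1)) * μ.real (G ∩ {ω | (n : ℝ) ≤ Y ω})
      ≤ ∑ n ∈ Finset.range N, ((if (n : ℝ) < t₀ then Real.exp (ε * (t₀ + 1)) else 0) + C * A * Real.exp (-1 : ℝ) ^ n) :=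
        Finset.sum_le_sum fun n _ => hsplit n
    _ = (∑ n ∈ Finset.range N, (if (n : ℝ) < t₀ then Real.exp (ε * (t₀ + 1)) else 0)) +
          ∑ n ∈ Finset.range N, C * A * Real.exp (-1 : ℝ) ^ n := Finset.sum_add_distrib
    _ ≤ (t₀ + 1) * Real.exp (ε * (t₀ + 1)) + 2 * C * A := add_le_add hcount hgeom

/-! ## §2 The line's objects: the LocalInsertionL integrand at one instance, from a tail on an arbitrary measurable event -/

/-- Positivity of the running coupling `g_h = √(γ·L^{−h})` for `γ > 0`. [cite: Balaban1985UV3, (3) p.256] -/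
theorem coupling_pos (F : T3Family) {γ : ℝ} (hγ : 0 < γ) (h : ℕ) : 0 < Real.sqrt (γ * ((F.L : ℝ)⁻¹) ^ h) := by
  have hL0 : (0 : ℝ) < F.L := by exact_mod_cast lt_trans zero_lt_one F.hL.2
  exact Real.sqrt_pos.2 (mul_pos hγ (pow_pos (inv_pos.2 hL0) _))

/-- **LINEAR-EXPONENTIAL TAIL ⇒ THE INSERTION INTEGRAL**, one instance, arbitrary measurable event `G`: if
`Gibbs_K(G ∩ {n·g_{K−j} ≤ dist1(Ū^j(∂a))}) ≤ C·e^{−κn}` for every `n : ℕ` and `0 ≤ ε < κ`, then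
`∫_G exp(ε·min(dist1(Ū^j(∂a))/g_{K−j}, p(g_{K−j}))) dGibbs_K ≤ C·e^{ε}/(1 − e^{ε−κ})` — for EVERY profile `(b₀, p₀)`.
[cite: Balaban1985UV3, (7) p.257 and (71) p.273] -/
theorem insertionIntegral_le_of_expTail (F : T3Family) {γ ε κ C : ℝ} (hγ : 0 < γ) (hε : 0 ≤ ε) (hεκ : ε < κ) (hC : 0 ≤ C)
    (b₀ p₀ : ℝ) {K j : ℕ} (a : Plaq (F.P K) j)
    {G : Set (GaugeField (F.P K) 0 (Matrix.specialUnitaryGroup (Fin 2) ℂ))} (hG : MeasurableSet G)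
    (htail : ∀ n : ℕ, (gibbsK F ℰp γ K).real (G ∩ {U | (n : ℝ) * Real.sqrt (γ * ((F.L : ℝ)⁻¹) ^ (K - j)) ≤ GaugeGroup.dist1 (GaugeField.plaqHol (Averaging.iter (fun i' => BlockAveraging.blockAvg (P := F.P K) (j := i') ℰp) j U) a)}) ≤ C * Real.exp (-(κ * n))) :
    ∫ U in G, Real.exp (ε * min (GaugeGroup.dist1 (GaugeField.plaqHol (Averaging.iter (fun i' => BlockAveraging.blockAvg (P := F.P K) (j := i') ℰp) j U) a) / Real.sqrt (γ * ((F.L : ℝ)⁻¹) ^ (K - j))) (B10.pFun b₀ p₀ (Real.sqrt (γ * ((F.L : ℝ)⁻¹) ^ (K - j))))) ∂(gibbsK F ℰp γ K) ≤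
      C * Real.exp ε / (1 - Real.exp (ε - κ)) := by
  haveI := isProbabilityMeasure_gibbsK F ℰp hγ.le K
  have hg := coupling_pos F hγ (K - j)
  have hset : ∀ n : ℕ, G ∩ {U : GaugeField (F.P K) 0 (Matrix.specialUnitaryGroup (Fin 2) ℂ) | (n : ℝ) ≤ GaugeGroup.dist1 (GaugeField.plaqHol (Averaging.iter (fun i' => BlockAveraging.blockAvg (P := F.P K) (j := i') ℰp) j U) a) / Real.sqrt (γ * ((F.L : ℝ)⁻¹) ^ (K - j))} =
      G ∩ {U | (n : ℝ) * Real.sqrt (γ * ((F.L : ℝ)⁻¹) ^ (K - j)) ≤ GaugeGroup.dist1 (GaugeField.plaqHol (Averaging.iter (fun i' => BlockAveraging.blockAvg (P := F.P K) (j := i') ℰp) j U) a)} := by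
    intro n; ext U; simp only [Set.mem_inter_iff, Set.mem_setOf_eq, le_div_iff₀ hg]
  refine setIntegral_exp_mul_min_le_of_expTail (gibbsK F ℰp γ K) hG ((measurable_flux F K j a).div_const _)
    (fun U _ => div_nonneg (GaugeGroup.dist1_nonneg _) (Real.sqrt_nonneg _)) hε hεκ hC (fun n => ?_) _
  rw [hset n]; exact htail n

/-- **GAUSSIAN TAIL BEYOND A THRESHOLD ⇒ THE INSERTION INTEGRAL**, one instance, arbitrary measurable event `G`: if
`Gibbs_K(G ∩ {n·g_{K−j} ≤ dist1(Ū^j(∂a))}) ≤ C·e^{−cn²}` for every `n : ℕ` with `t₀ ≤ n` (`c > 0`), then for EVERY `ε ≥ 0` and every profile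
`∫_G exp(ε·min(dist1(Ū^j(∂a))/g_{K−j}, p(g_{K−j}))) dGibbs_K ≤ (t₀+1)·e^{ε(t₀+1)} + 2C·e^{ε + (ε+1)²/(4c)}`.
[cite: Balaban1985UV3, (7) p.257 and (71) p.273] -/
theorem insertionIntegral_le_of_gaussTail (F : T3Family) {γ ε c C t₀ : ℝ} (hγ : 0 < γ) (hε : 0 ≤ ε) (hc : 0 < c) (hC : 0 ≤ C)
    (ht₀ : 0 ≤ t₀) (b₀ p₀ : ℝ) {K j : ℕ} (a : Plaq (F.P K) j)
    {G : Set (GaugeField (F.P K) 0 (Matrix.specialUnitaryGroup (Fin 2) ℂ))} (hG : MeasurableSet G)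
    (htail : ∀ n : ℕ, t₀ ≤ (n : ℝ) → (gibbsK F ℰp γ K).real (G ∩ {U | (n : ℝ) * Real.sqrt (γ * ((F.L : ℝ)⁻¹) ^ (K - j)) ≤ GaugeGroup.dist1 (GaugeField.plaqHol (Averaging.iter (fun i' => BlockAveraging.blockAvg (P := F.P K) (j := i') ℰp) j U) a)}) ≤ C * Real.exp (-(c * (n : ℝ) ^ 2))) :
    ∫ U in G, Real.exp (ε * min (GaugeGroup.dist1 (GaugeField.plaqHol (Averaging.iter (fun i' => BlockAveraging.blockAvg (P := F.P K) (j := i') ℰp) j U) a) / Real.sqrt (γ * ((F.L : ℝ)⁻¹) ^ (K - j))) (B10.pFun b₀ p₀ (Real.sqrt (γ * ((F.L : ℝ)⁻¹) ^ (K - j))))) ∂(gibbsK F ℰp γ K) ≤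
      (t₀ + 1) * Real.exp (ε * (t₀ + 1)) + 2 * C * Real.exp (ε + (ε + 1) ^ 2 / (4 * c)) := by
  haveI := isProbabilityMeasure_gibbsK F ℰp hγ.le K
  have hg := coupling_pos F hγ (K - j)
  have hset : ∀ n : ℕ, G ∩ {U : GaugeField (F.P K) 0 (Matrix.specialUnitaryGroup (Fin 2) ℂ) | (n : ℝ) ≤ GaugeGroup.dist1 (GaugeField.plaqHol (Averaging.iter (fun i' => BlockAveraging.blockAvg (P := F.P K) (j := i') ℰp) j U) a) / Real.sqrt (γ * ((F.L : ℝ)⁻¹) ^ (K - j))} =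
      G ∩ {U | (n : ℝ) * Real.sqrt (γ * ((F.L : ℝ)⁻¹) ^ (K - j)) ≤ GaugeGroup.dist1 (GaugeField.plaqHol (Averaging.iter (fun i' => BlockAveraging.blockAvg (P := F.P K) (j := i') ℰp) j U) a)} := by
    intro n; ext U; simp only [Set.mem_inter_iff, Set.mem_setOf_eq, le_div_iff₀ hg]
  refine setIntegral_exp_mul_min_le_of_gaussTail (gibbsK F ℰp γ K) hG ((measurable_flux F K j a).div_const _)
    (fun U _ => div_nonneg (GaugeGroup.dist1_nonneg _) (Real.sqrt_nonneg _)) hε hc hC ht₀ (fun n hn => ?_) _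
  rw [hset n]; exact htail n hn

/-! ## §3 Packaging, by name: the window tail gives `LocalInsertionL` and both registered stub signatures -/

/-- The local small-history event `G(a,j)` of the line is measurable. [cite: Balaban1985UV3, (7) p.257] -/
theorem measurableSet_window (F : T3Family) (γ b₀ p₀ : ℝ) (K j : ℕ) (a : Plaq (F.P K) j) :
    MeasurableSet {U : GaugeField (F.P K) 0 (Matrix.specialUnitaryGroup (Fin 2) ℂ) | (∀ (i : ℕ) (q : Plaq (F.P K) i), i < j → Site.tdist (fun k => ((((q.src k).val * F.L ^ i : ℕ)) : ZMod ((F.P K).sitesPerDir 0))) (fun k => ((((a.src k).val * F.L ^ j : ℕ)) : ZMod ((F.P K).sitesPerDir 0))) + 64 * F.L ^ i ≤ 64 * F.L ^ j → GaugeGroup.dist1 (GaugeField.plaqHol (Averaging.iter (fun i' => BlockAveraging.blockAvg (P := F.P K) (j := i') ℰp) i U) q) < θBal F.L γ b₀ p₀ (K - i))} :=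
  measurableSet_localGood F (fun i => θBal F.L γ b₀ p₀ (K - i)) K j
    (fun i q => Site.tdist (fun k => ((((q.src k).val * F.L ^ i : ℕ)) : ZMod ((F.P K).sitesPerDir 0))) (fun k => ((((a.src k).val * F.L ^ j : ℕ)) : ZMod ((F.P K).sitesPerDir 0))) + 64 * F.L ^ i ≤ 64 * F.L ^ j)

/-- `e^{ε}/(1 − e^{ε−κ})` is non-negative for `ε < κ`. [folklore] -/
theorem momentConst_nonneg {ε κ C : ℝ} (hεκ : ε < κ) (hC : 0 ≤ C) : 0 ≤ C * Real.exp ε / (1 - Real.exp (ε - κ)) := by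
  have : Real.exp (ε - κ) < 1 := Real.exp_lt_one_iff.mpr (by linarith)
  exact div_nonneg (mul_nonneg hC (Real.exp_pos _).le) (by linarith)

/-- **THE WINDOW TAIL GIVES `LocalInsertionL`** (stmt-QuantumFields-23607, BY NAME): a K-, j- and plaquette-uniform linear-exponential tail
`Gibbs_K(G(a,j) ∩ {n·g_{K−j} ≤ dist1(Ū^j(∂a))}) ≤ C·e^{−κn}` (`n : ℕ`; `κ = κ(L) > 0`, `C = C(L,b₀,p₀)`, `γ ≤ γ₁(L,b₀,p₀)`) at every height
`1 ≤ j ≤ K` implies the fixed-`ε` capped exponential moment with `ε := κ/2`, `M₀ := C·e^{κ/2}/(1 − e^{−κ/2})`.  CONDITIONAL: the hypothesis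
is not in the tree. [cite: Balaban1985UV3, (7) p.257 and (71) p.273] -/
theorem localInsertionL_of_windowExpTail
    (hT : ∀ (L : ℕ), ∃ κ : ℝ, 0 < κ ∧ ∀ (b₀ p₀ : ℝ), 0 < b₀ → 2 < p₀ → ∃ C : ℝ, 0 ≤ C ∧ ∃ γ₁ : ℝ, 0 < γ₁ ∧ γ₁ ≤ 1 ∧ ∀ (F : T3Family) (γ : ℝ), F.L = L → 0 < γ → γ ≤ γ₁ → ∀ (K j : ℕ), 1 ≤ j → j ≤ K → ∀ (a : Plaq (F.P K) j) (n : ℕ), (gibbsK F ℰp γ K).real ({U : GaugeField (F.P K) 0 (Matrix.specialUnitaryGroup (Fin 2) ℂ) | (∀ (i : ℕ) (q : Plaq (F.P K) i), i < j → Site.tdist (fun k => ((((q.src k).val * F.L ^ i : ℕ)) : ZMod ((F.P K).sitesPerDir 0))) (fun k => ((((a.src k).val * F.L ^ j : ℕ)) : ZMod ((F.P K).sitesPerDir 0))) + 64 * F.L ^ i ≤ 64 * F.L ^ j → GaugeGroup.dist1 (GaugeField.plaqHol (Averaging.iter (fun i' => BlockAveraging.blockAvg (P := F.P K) (j := i')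 ℰp) i U) q) < θBal F.L γ b₀ p₀ (K - i))} ∩ {U | (n : ℝ) * Real.sqrt (γ * ((F.L : ℝ)⁻¹) ^ (K - j)) ≤ GaugeGroup.dist1 (GaugeField.plaqHol (Averaging.iter (fun i' => BlockAveraging.blockAvg (P := F.P K) (j := i') ℰp) j U) a)}) ≤ C * Real.exp (-(κ * n))) :
    Summit.QuantumFields.YangMills.Theses.LocalInsertion.LocalInsertionL := by
  intro L
  obtain ⟨κ, hκ, hL⟩ := hT L
  refine ⟨κ / 2, by linarith, fun b₀ p₀ hb₀ hp₀ => ?_⟩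
  obtain ⟨C, hC, γ₁, hγ₁, hγ₁1, hF⟩ := hL b₀ p₀ hb₀ hp₀
  have hεκ : κ / 2 < κ := by linarith
  refine ⟨C * Real.exp (κ / 2) / (1 - Real.exp (κ / 2 - κ)), momentConst_nonneg hεκ hC, γ₁, hγ₁, hγ₁1,
    fun F γ hFL hγ hγle K j hj hjK a => ?_⟩
  exact insertionIntegral_le_of_expTail F hγ (by linarith) hεκ hC b₀ p₀ a (measurableSet_window F γ b₀ p₀ K j a)
    (hF F γ hFL hγ hγle K j hj hjK a)

/-- **THE WINDOW TAIL AT HEIGHT ONE GIVES THE REGISTERED STUB `stub_insertionHeightOne`'S SIGNATURE** (line `local_insertion` 48f0ac19,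
verbatim conclusion; `ε₀ := κ/2`, and for `0 < ε ≤ ε₀`: `M₀(ε) := C·e^{ε}/(1 − e^{ε−κ})`).  CONDITIONAL: the hypothesis (the tail at heights
`j ≤ 1`) is not in the tree. [cite: Balaban1985UV3, (7) p.257 and (71) p.273] -/
theorem insertionHeightOne_of_windowExpTail
    (hT : ∀ (L : ℕ), ∃ κ : ℝ, 0 < κ ∧ ∀ (b₀ p₀ : ℝ), 0 < b₀ → 2 < p₀ → ∃ C : ℝ, 0 ≤ C ∧ ∃ γ₁ : ℝ, 0 < γ₁ ∧ γ₁ ≤ 1 ∧ ∀ (F : T3Family) (γ : ℝ), F.L = L → 0 < γ → γ ≤ γ₁ → ∀ (K j : ℕ), 1 ≤ j → j ≤ K → j ≤ 1 → ∀ (a : Plaq (F.P K) j) (n : ℕ), (gibbsK F ℰp γ K).real ({U : GaugeField (F.P K) 0 (Matrix.specialUnitaryGroup (Fin 2) ℂ) | (∀ (i : ℕ) (q : Plaq (F.P K) i), i < j → Site.tdist (fun k => ((((q.src k).val * F.L ^ i : ℕ)) : ZMod ((F.P K).sitesPerDir 0))) (fun k => ((((a.src k).val * F.L ^ j : ℕ))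 : ZMod ((F.P K).sitesPerDir 0))) + 64 * F.L ^ i ≤ 64 * F.L ^ j → GaugeGroup.dist1 (GaugeField.plaqHol (Averaging.iter (fun i' => BlockAveraging.blockAvg (P := F.P K) (j := i') ℰp) i U) q) < θBal F.L γ b₀ p₀ (K - i))} ∩ {U | (n : ℝ) * Real.sqrt (γ * ((F.L : ℝ)⁻¹) ^ (K - j)) ≤ GaugeGroup.dist1 (GaugeField.plaqHol (Averaging.iter (fun i' => BlockAveraging.blockAvg (P := F.P K) (j := i') ℰp) j U) a)}) ≤ C * Real.exp (-(κ * n))) :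
    open Literature.MathematicalPhysics.QuantumFieldTheory.Balaban1983to89 Literature.MathematicalPhysics.QuantumFieldTheory.Balaban1983to89.T3ContinuumYM3Torus in ∀ (L : ℕ), ∃ ε₀ : ℝ, 0 < ε₀ ∧ ∀ (ε : ℝ), 0 < ε → ε ≤ ε₀ → ∀ (b₀ p₀ : ℝ), 0 < b₀ → 2 < p₀ → ∃ M₀ : ℝ, 0 ≤ M₀ ∧ ∃ γ₁ : ℝ, 0 < γ₁ ∧ γ₁ ≤ 1 ∧ ∀ (F : T3Family) (γ : ℝ), F.L = L → 0 < γ → γ ≤ γ₁ → ∀ (K j : ℕ), 1 ≤ j → j ≤ K → j ≤ 1 → ∀ (a : Plaq (F.P K) j), ∫ U in {U | (∀ (i : ℕ) (q : Plaq (F.P K) i), i < j → Site.tdist (fun k => ((((q.src k).val * F.L ^ i : ℕ)) : ZMod ((F.P K).sitesPerDir 0))) (fun k => ((((a.src k).val * F.L ^ j : ℕ)) : ZMod ((F.P K).sitesPerDir 0))) + 64 * F.L ^ i ≤ 64 * F.L ^ j → GaugeGroup.dist1 (GaugeField.plaqHol (Averaging.iter (fun i' => BlockAveraging.blockAvg (P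 := F.P K) (j := i') T3UnitLawDensityEML.ℰp) i U) q) < T3UnitScaleTilt.θBal F.L γ b₀ p₀ (K - i))}, Real.exp (ε * min (GaugeGroup.dist1 (GaugeField.plaqHol (Averaging.iter (fun i' => BlockAveraging.blockAvg (P := F.P K) (j := i') T3UnitLawDensityEML.ℰp) j U) a) / Real.sqrt (γ * ((F.L : ℝ)⁻¹) ^ (K - j))) (B10.pFun b₀ p₀ (Real.sqrt (γ * ((F.L : ℝ)⁻¹) ^ (K - j))))) ∂(T3UnitScaleTilt.gibbsK F T3UnitLawDensityEML.ℰp γ K) ≤ M₀ := by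
  intro L
  obtain ⟨κ, hκ, hL⟩ := hT L
  refine ⟨κ / 2, by linarith, fun ε hε hεle b₀ p₀ hb₀ hp₀ => ?_⟩
  obtain ⟨C, hC, γ₁, hγ₁, hγ₁1, hF⟩ := hL b₀ p₀ hb₀ hp₀
  have hεκ : ε < κ := by linarith
  refine ⟨C * Real.exp ε / (1 - Real.exp (ε - κ)), momentConst_nonneg hεκ hC, γ₁, hγ₁, hγ₁1,
    fun F γ hFL hγ hγle K j hj hjK hj1 a => ?_⟩
  exact insertionIntegral_le_of_expTail F hγ hε.le hεκ hC b₀ p₀ a (measurableSet_window F γ b₀ p₀ K j a)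
    (hF F γ hFL hγ hγle K j hj hjK hj1 a)

/-- **THE WINDOW TAIL AT HEIGHTS `j ≥ 2` GIVES THE REGISTERED STUB `stub_insertionHigher`'S SIGNATURE** (line `local_insertion` 48f0ac19,
verbatim conclusion; `ε₀ := κ/2`, `M₀(ε) := C·e^{ε}/(1 − e^{ε−κ})`).  CONDITIONAL: the hypothesis (the tail at heights `2 ≤ j`) is not in
the tree — it is the organ-adjacent content of the line. [cite: Balaban1985UV3, (7) p.257 and (71) p.273] -/
theorem insertionHigher_of_windowExpTail
    (hT : ∀ (L : ℕ), ∃ κ : ℝ, 0 < κ ∧ ∀ (b₀ p₀ : ℝ), 0 < b₀ → 2 < p₀ → ∃ C : ℝ, 0 ≤ C ∧ ∃ γ₁ : ℝ, 0 < γ₁ ∧ γ₁ ≤ 1 ∧ ∀ (F : T3Family) (γ : ℝ), F.L = L → 0 < γ → γ ≤ γ₁ → ∀ (K j : ℕ), 1 ≤ j → j ≤ K → 2 ≤ j → ∀ (a : Plaq (F.P K) j) (n : ℕ), (gibbsK F ℰp γ K).real ({U : GaugeField (F.P K) 0 (Matrix.specialUnitaryGroup (Fin 2) ℂ) | (∀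 (i : ℕ) (q : Plaq (F.P K) i), i < j → Site.tdist (fun k => ((((q.src k).val * F.L ^ i : ℕ)) : ZMod ((F.P K).sitesPerDir 0))) (fun k => ((((a.src k).val * F.L ^ j : ℕ)) : ZMod ((F.P K).sitesPerDir 0))) + 64 * F.L ^ i ≤ 64 * F.L ^ j → GaugeGroup.dist1 (GaugeField.plaqHol (Averaging.iter (fun i' => BlockAveraging.blockAvg (P := F.P K) (j := i') ℰp) i U) q) < θBal F.L γ b₀ p₀ (K - i))} ∩ {U | (n : ℝ) * Real.sqrt (γ * ((F.L : ℝ)⁻¹) ^ (K - j)) ≤ GaugeGroup.dist1 (GaugeField.plaqHol (Averaging.iter (fun i' => BlockAveraging.blockAvg (P := F.P K) (j := i') ℰp) j U) a)}) ≤ C * Real.exp (-(κ * n))) :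
    open Literature.MathematicalPhysics.QuantumFieldTheory.Balaban1983to89 Literature.MathematicalPhysics.QuantumFieldTheory.Balaban1983to89.T3ContinuumYM3Torus in ∀ (L : ℕ), ∃ ε₀ : ℝ, 0 < ε₀ ∧ ∀ (ε : ℝ), 0 < ε → ε ≤ ε₀ → ∀ (b₀ p₀ : ℝ), 0 < b₀ → 2 < p₀ → ∃ M₀ : ℝ, 0 ≤ M₀ ∧ ∃ γ₁ : ℝ, 0 < γ₁ ∧ γ₁ ≤ 1 ∧ ∀ (F : T3Family) (γ : ℝ), F.L = L → 0 < γ → γ ≤ γ₁ → ∀ (K j : ℕ), 1 ≤ j → j ≤ K → 2 ≤ j → ∀ (a : Plaq (F.P K) j), ∫ U in {U | (∀ (i : ℕ) (q : Plaq (F.P K) i), i < j → Site.tdist (fun k => ((((q.src k).val * F.L ^ i : ℕ)) : ZMod ((F.P K).sitesPerDir 0))) (fun k => ((((a.src k).val * F.L ^ j : ℕ)) : ZMod ((F.P K).sitesPerDir 0))) + 64 * F.L ^ i ≤ 64 * F.L ^ j → GaugeGroup.dist1 (GaugeField.plaqHol (Averaging.iter (fun i' => BlockAveraging.blockAvg (P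 := F.P K) (j := i') T3UnitLawDensityEML.ℰp) i U) q) < T3UnitScaleTilt.θBal F.L γ b₀ p₀ (K - i))}, Real.exp (ε * min (GaugeGroup.dist1 (GaugeField.plaqHol (Averaging.iter (fun i' => BlockAveraging.blockAvg (P := F.P K) (j := i') T3UnitLawDensityEML.ℰp) j U) a) / Real.sqrt (γ * ((F.L : ℝ)⁻¹) ^ (K - j))) (B10.pFun b₀ p₀ (Real.sqrt (γ * ((F.L : ℝ)⁻¹) ^ (K - j))))) ∂(T3UnitScaleTilt.gibbsK F T3UnitLawDensityEML.ℰp γ K) ≤ M₀ := by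
  intro L
  obtain ⟨κ, hκ, hL⟩ := hT L
  refine ⟨κ / 2, by linarith, fun ε hε hεle b₀ p₀ hb₀ hp₀ => ?_⟩
  obtain ⟨C, hC, γ₁, hγ₁, hγ₁1, hF⟩ := hL b₀ p₀ hb₀ hp₀
  have hεκ : ε < κ := by linarith
  refine ⟨C * Real.exp ε / (1 - Real.exp (ε - κ)), momentConst_nonneg hεκ hC, γ₁, hγ₁, hγ₁1,
    fun F γ hFL hγ hγle K j hj hjK hj2 a => ?_⟩
  exact insertionIntegral_le_of_expTail F hγ hε.le hεκ hC b₀ p₀ a (measurableSet_window F γ b₀ p₀ K j a)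
    (hF F γ hFL hγ hγle K j hj hjK hj2 a)

end Summit.QuantumFields.YangMills.Theorems.LocalInsertion.MomentOfWindowTail
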